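import Mathlib.MeasureTheory.Integral.IntervalIntegral.AbsolutelyContinuousFun
import Mathlib.MeasureTheory.Integral.IntervalIntegral.Periodic
import Mathlib.Analysis.BoundedVariation
import Mathlib.Analysis.Calculus.Deriv.Shift
import Mathlib.Analysis.Calculus.FDeriv.Measurable
import Mathlib.Analysis.InnerProductSpace.Calculus
import Mathlib.MeasureTheory.Function.SpecialFunctions.Inner
import Literature.Analysis.FluidPDE.VortexFilamentEnergy

/-!
# Closed Lipschitz curves with `κ*` in weak-`L¹`: loop distance, closedness, and Lemma 4

Support file for the proof of the Jerrard–Seis energy lower bound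
(`Literature.Analysis.FluidPDE.VortexFilament.JerrardSeis2016_filamentEnergyLowerBound`,
file `VortexFilamentEnergy.lean`). Source: R. L. Jerrard, C. Seis, *On the vortex filament
conjecture for Euler flows*, ARMA 224 (2017) = arXiv:1603.00227 [JerrardSeis2016], §2.1 and §4.1.

## Contents

* `loopDist` lemmas (the distance on `ℝ/Lℤ`): `≤ |h|`, `≤ L/2`, `= |h|` for `|h| ≤ L/2`,
  periodicity.
* `IsArclengthLoop` API: continuity, `‖γ'‖ ≤ 1`, periodicity of `γ'`, a.e. differentiability
  (Rademacher on the line, `LipschitzWith.ae_differentiableAt_real`), and the fundamental theorem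
  of calculus in the tested form `⟪γ b − γ a, v⟫ = ∫_a^b ⟪γ', v⟫`
  (`AbsolutelyContinuousOnInterval.integral_deriv_eq_sub` applied to the Lipschitz scalar
  function `⟪γ ·, v⟫`), whence `∮ ⟪γ', v⟫ = 0` over a period.
* Consequences of the security-radius conditions (§2.1 eq. (1)): the inner-product form of the
  second condition, `1 − (|h|_L/ρ)²/2 ≤ ⟪γ'(s+h), γ'(s)⟫`; admissible radii are `≤ L/2` at
  unit-speed parameters (the curve is closed), hence `κ* ≥ 2/L` a.e. and the weak-`L¹` bound `K`
  in the hypothesis of Theorem 1 satisfies `K ≥ 2` (the paper's "`κ* ≥ 1`, `‖κ*‖ ≥ 1`" for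
  `L = 1`, §4.1, proof of Lemma 4).
* **Lemma 4** (§4.1): `|{s ∈ [0,L) : |γ(s) − x| < r}| ≤ 24 r K` for all `x ∈ EuclideanSpace ℝ (Fin 3)`, `r > 0`
  (`IsArclengthLoop.volume_near_le`; the paper's constant is `8`, ours `24`, immaterial).

## Proof notes

Lemma 4 follows the printed proof: either the near-set `A` lies in a loop-ball of radius `4r`
(measure `≤ 8r`, via the Haar measure of balls in `AddCircle L`), or every `s ∈ A` has a far
companion `t ∈ A` (loop distance `> 4r`, chord `< 2r`), and then every admissible radius at `s`
is `≤ 4r` (`mem_securityRadii_le_of_far`): the first admissibility condition fails if `ρ ≤ |t−s|_L`,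
and otherwise the second one forces `⟪γ'(s+h), γ'(s)⟫ > 1/2` along the parameter arc, so the
chord would be `≥ |t−s|_L/2 > 2r` by the fundamental theorem of calculus. Hence
`A ⊆ {κ* ≥ 1/(4r)}` up to a null set and the weak-`L¹` bound gives `|A| ≤ 4rK`.
-/

noncomputable section

open MeasureTheory Set Function Filter
open scoped InnerProductSpace RealInnerProductSpace ENNReal NNReal Topology

namespace Literature.Analysis.FluidPDE

namespace VortexFilament

/-! ### The loop distance -/

/-- `loopDist L h ≤ |h|`. [folklore] -/
theorem loopDist_le_abs (L h : ℝ) : loopDist L h ≤ |h| := by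
  rw [loopDist, ← Real.norm_eq_abs]
  exact QuotientAddGroup.norm_mk_le_norm

/-- `loopDist L h ≤ L / 2` for `0 < L`. [folklore] -/
theorem loopDist_le_half {L : ℝ} (hL : 0 < L) (h : ℝ) : loopDist L h ≤ L / 2 := by
  have := AddCircle.norm_le_half_period (p := L) (x := ((h : ℝ) : AddCircle L)) hL.ne'
  rwa [abs_of_pos hL] at this

/-- For `|h| ≤ L/2` the loop distance is `|h|`. [folklore] -/
theorem loopDist_eq_abs {L h : ℝ} (hL : 0 < L) (hh : |h| ≤ L / 2) : loopDist L h = |h| := by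
  rw [loopDist, AddCircle.norm_coe_eq_abs_iff L hL.ne', abs_of_pos hL]
  exact hh

/-- The loop distance is `L`-periodic. [folklore] -/
theorem loopDist_add_period (L h : ℝ) : loopDist L (h + L) = loopDist L h := by
  simp [loopDist]

/-- The loop distance is invariant under subtracting integer multiples of the period. [folklore] -/
theorem loopDist_sub_int_mul (L h : ℝ) (k : ℤ) : loopDist L (h - k * L) = loopDist L h := by
  simp [loopDist, AddCircle.coe_period]

/-! ### Arclength loops: basic properties -/

namespace IsArclengthLoop

variable {L : ℝ} {γ : ℝ → EuclideanSpace ℝ (Fin 3)} (hγ : IsArclengthLoop L γ)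
include hγ

/-- `‖γ'(s)‖ ≤ 1` everywhere (junk value `0` included). [folklore] -/
theorem norm_deriv_le_one (s : ℝ) : ‖deriv γ s‖ ≤ 1 := by
  have := norm_deriv_le_of_lipschitz (x₀ := s) hγ.lipschitz
  simpa using this

/-- `γ'` is `L`-periodic. [folklore] -/
theorem periodic_deriv : Function.Periodic (deriv γ) L := by
  intro s
  have h : (fun x => γ (x + L)) = γ := funext hγ.periodic
  rw [← deriv_comp_add_const, h]

/-- Differentiability of `γ` is `L`-periodic. [folklore] -/
theorem differentiableAt_add_period {s : ℝ} :
    DifferentiableAt ℝ γ (s + L) ↔ DifferentiableAt ℝ γ s := by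
  have h : (fun x => γ (x + L)) = γ := funext hγ.periodic
  constructor
  · intro hd
    have : DifferentiableAt ℝ (fun x => γ (x + L)) s := hd.comp s (differentiableAt_id.add_const L)
    rwa [h] at this
  · intro hd
    have h' : (fun x => γ (x - L)) = γ := by
      funext x; have := hγ.periodic (x - L); rw [sub_add_cancel] at this; exact this.symm
    have : DifferentiableAt ℝ (fun x => γ (x - L)) (s + L) := by
      refine DifferentiableAt.comp (s + L) ?_ (differentiableAt_id.sub_const L)
      rwa [add_sub_cancel_right]
    rwa [h'] at this

/-- `γ` is differentiable at a.e. parameter (Rademacher on the line). [folklore] -/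
theorem ae_differentiableAt : ∀ᵐ s : ℝ, DifferentiableAt ℝ γ s :=
  hγ.lipschitz.ae_differentiableAt_real

/-- The "good" parameters: `γ` differentiable with unit speed, a.e. [folklore] -/
theorem ae_good : ∀ᵐ s : ℝ, DifferentiableAt ℝ γ s ∧ ‖deriv γ s‖ = 1 :=
  hγ.ae_differentiableAt.and hγ.norm_deriv_ae

/-- Shifted version of the unit-speed property: for every `s`, `‖γ'(s + h)‖ = 1` for a.e. `h`.
[folklore] -/
theorem ae_norm_deriv_add (s : ℝ) : ∀ᵐ h : ℝ, ‖deriv γ (s + h)‖ = 1 := by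
  have := (measurePreserving_add_left volume s).quasiMeasurePreserving.ae hγ.norm_deriv_ae
  simpa using this

/-- Fundamental theorem of calculus for the Lipschitz loop, tested against a fixed vector:
`⟪γ b − γ a, v⟫ = ∫_a^b ⟪γ' σ, v⟫ dσ`. [folklore] -/
theorem inner_sub_eq_integral (v : EuclideanSpace ℝ (Fin 3)) (a b : ℝ) :
    ⟪γ b - γ a, v⟫ = ∫ σ in a..b, ⟪deriv γ σ, v⟫ := by
  set φ : ℝ → ℝ := fun σ => ⟪γ σ, v⟫ with hφ
  have hlip : LipschitzWith (‖v‖₊ * 1) φ := by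
    have h1 : LipschitzWith ‖v‖₊ (fun p : EuclideanSpace ℝ (Fin 3) => ⟪p, v⟫) := by
      refine LipschitzWith.of_dist_le_mul fun p q => ?_
      rw [Real.dist_eq, ← inner_sub_left, dist_eq_norm, coe_nnnorm]
      calc |⟪p - q, v⟫| ≤ ‖p - q‖ * ‖v‖ := abs_real_inner_le_norm _ _
        _ = ‖v‖ * ‖p - q‖ := mul_comm _ _
    exact h1.comp hγ.lipschitz
  have hac : AbsolutelyContinuousOnInterval φ a b :=
    (hlip.lipschitzOnWith).absolutelyContinuousOnInterval
  have hftc := hac.integral_deriv_eq_sub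
  have hderiv : ∀ᵐ σ : ℝ, deriv φ σ = ⟪deriv γ σ, v⟫ := by
    filter_upwards [hγ.ae_differentiableAt] with σ hσ
    have : HasDerivAt φ ⟪deriv γ σ, v⟫ σ := by
      have h := hσ.hasDerivAt.inner ℝ (hasDerivAt_const σ v)
      simpa using h
    exact this.deriv
  rw [inner_sub_left]
  change φ b - φ a = _
  rw [← hftc]
  exact intervalIntegral.integral_congr_ae (hderiv.mono fun _ h _ => h)

/-- Over a full period the tangent integrates to zero against any vector. [folklore] -/
theorem integral_inner_deriv_period (v : EuclideanSpace ℝ (Fin 3)) (a : ℝ) :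
    ∫ σ in a..a + L, ⟪deriv γ σ, v⟫ = 0 := by
  rw [← hγ.inner_sub_eq_integral, hγ.periodic, sub_self, inner_zero_left]

end IsArclengthLoop

/-! ### Consequences of the security-radius conditions -/

section Security

variable {L : ℝ} {γ : ℝ → EuclideanSpace ℝ (Fin 3)}

/-- `⟪a, b⟫ = (‖a‖² + ‖b‖² − ‖a − b‖²)/2`. [folklore] -/
theorem real_inner_eq_norm_sq_sub (a b : EuclideanSpace ℝ (Fin 3)) :
    ⟪a, b⟫ = (‖a‖ ^ 2 + ‖b‖ ^ 2 - ‖a - b‖ ^ 2) / 2 := by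
  rw [norm_sub_sq_real]; ring

/-- The second admissibility condition bounds `⟪γ'(s+h), γ'(s)⟫` from below at unit-speed
parameters: `1 − (|h|_L/ρ)²/2 ≤ ⟪γ'(s+h), γ'(s)⟫`. [cite: JerrardSeis2016, §4.1 proof of Lemma 3] -/
theorem inner_deriv_ge_of_mem_securityRadii {s ρ h : ℝ} (hρ : ρ ∈ securityRadii L γ s)
    (hh : loopDist L h ≤ ρ) (hs : ‖deriv γ s‖ = 1) (hsh : ‖deriv γ (s + h)‖ = 1) :
    1 - (loopDist L h / ρ) ^ 2 / 2 ≤ ⟪deriv γ (s + h), deriv γ s⟫ := by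
  have hb := hρ.2.2 h hh
  rw [real_inner_eq_norm_sq_sub, hs, hsh]
  have h0 : 0 ≤ ‖deriv γ (s + h) - deriv γ s‖ := norm_nonneg _
  have : ‖deriv γ (s + h) - deriv γ s‖ ^ 2 ≤ (loopDist L h / ρ) ^ 2 := by
    exact pow_le_pow_left₀ h0 hb 2
  linarith

variable (hγ : IsArclengthLoop L γ)
include hγ

/-- Integrability of `h ↦ ⟪γ'(s + h), v⟫` on any interval. [folklore] -/
theorem IsArclengthLoop.intervalIntegrable_inner_deriv_add (s : ℝ) (v : EuclideanSpace ℝ (Fin 3)) (a b : ℝ) :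
    IntervalIntegrable (fun h => ⟪deriv γ (s + h), v⟫) volume a b := by
  have hmeas : Measurable fun h => ⟪deriv γ (s + h), v⟫ :=
    Measurable.inner_const ((_root_.measurable_deriv γ).comp (measurable_const_add s))
  refine (intervalIntegrable_const (c := ‖v‖)).mono_fun' hmeas.aestronglyMeasurable ?_
  refine Filter.Eventually.of_forall fun h => ?_
  calc ‖⟪deriv γ (s + h), v⟫‖ ≤ ‖deriv γ (s + h)‖ * ‖v‖ := norm_inner_le_norm _ _
    _ ≤ 1 * ‖v‖ := by gcongr; exact hγ.norm_deriv_le_one _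
    _ = ‖v‖ := one_mul _

/-- **Admissible radii are at most `L/2`** at unit-speed parameters: the curve is closed, so the
tangent must turn around (`∮ γ' = 0`), which the second admissibility condition with `ρ > L/2`
forbids. [cite: JerrardSeis2016, §4.1 proof of Lemma 4 ("r(s) ≤ 1 for every s")] -/
theorem IsArclengthLoop.le_half_of_mem_securityRadii {s ρ : ℝ} (hs : ‖deriv γ s‖ = 1)
    (hρ : ρ ∈ securityRadii L γ s) : ρ ≤ L / 2 := by
  by_contra! hlt
  have hL := hγ.pos
  have hρpos : 0 < ρ := hρ.1
  set δ : ℝ := (L / 2) / ρ with hδ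
  have hδ1 : δ < 1 := (div_lt_one hρpos).2 hlt
  have hδ0 : 0 ≤ δ := by positivity
  have hae : ∀ᵐ h : ℝ, 1 - δ ^ 2 / 2 ≤ ⟪deriv γ (s + h), deriv γ s⟫ := by
    filter_upwards [hγ.ae_norm_deriv_add s] with h hh
    have hld : loopDist L h ≤ ρ := (loopDist_le_half hL h).trans hlt.le
    have h1 := inner_deriv_ge_of_mem_securityRadii hρ hld hs hh
    have h2 : loopDist L h / ρ ≤ δ := by
      rw [hδ]; gcongr; exact loopDist_le_half hL h
    have h3 : (loopDist L h / ρ) ^ 2 ≤ δ ^ 2 := by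
      have : 0 ≤ loopDist L h / ρ := div_nonneg (loopDist_nonneg _ _) hρpos.le
      exact pow_le_pow_left₀ this h2 2
    linarith
  have hint : ∫ h in (0:ℝ)..L, ⟪deriv γ (s + h), deriv γ s⟫ = 0 := by
    have := hγ.integral_inner_deriv_period (deriv γ s) s
    rw [intervalIntegral.integral_comp_add_left (fun σ => ⟪deriv γ σ, deriv γ s⟫) s, add_zero]
    exact this
  have hlow : ∫ h in (0:ℝ)..L, (1 - δ ^ 2 / 2) ≤ ∫ h in (0:ℝ)..L, ⟪deriv γ (s + h), deriv γ s⟫ :=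
    intervalIntegral.integral_mono_ae hL.le intervalIntegrable_const
      (hγ.intervalIntegrable_inner_deriv_add s (deriv γ s) 0 L) hae
  rw [intervalIntegral.integral_const, hint, smul_eq_mul, sub_zero] at hlow
  have hδ2 : δ ^ 2 < 1 := by nlinarith
  have : 0 < L * (1 - δ ^ 2 / 2) := mul_pos hL (by linarith)
  linarith

/-- At unit-speed parameters the security radius is at most `L/2`. [cite: JerrardSeis2016, §4.1 proof of Lemma 4] -/
theorem IsArclengthLoop.securityRadius_le_half {s : ℝ} (hs : ‖deriv γ s‖ = 1) :
    securityRadius L γ s ≤ ENNReal.ofReal (L / 2) := by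
  unfold securityRadius
  split_ifs with hd
  · exact iSup₂_le fun ρ hρ => ENNReal.ofReal_le_ofReal (hγ.le_half_of_mem_securityRadii hs hρ)
  · exact bot_le

/-- At unit-speed parameters `κ* ≥ 2/L`. [cite: JerrardSeis2016, §4.1 proof of Lemma 4 ("κ* ≥ 1")] -/
theorem IsArclengthLoop.ofReal_two_div_le_kappaStar {s : ℝ} (hs : ‖deriv γ s‖ = 1) :
    ENNReal.ofReal (2 / L) ≤ kappaStar L γ s := by
  have hL := hγ.pos
  unfold kappaStar
  have h := hγ.securityRadius_le_half hs
  have : ENNReal.ofReal (2 / L) = (ENNReal.ofReal (L / 2))⁻¹ := by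
    rw [← ENNReal.ofReal_inv_of_pos (by positivity)]
    congr 1; field_simp
  rw [this]
  exact ENNReal.inv_le_inv.2 h

/-- **The weak-`L¹` bound is at least `2`**: `κ* ≥ 2/L` a.e. on a period of length `L`.
[cite: JerrardSeis2016, §4.1 proof of Lemma 4 ("‖κ*‖ ≥ 1")] -/
theorem IsArclengthLoop.two_le_of_weakL1Norm_le {K : ℝ≥0}
    (hK : weakL1Norm L (kappaStar L γ) ≤ K) : (2 : ℝ) ≤ K := by
  have hL := hγ.pos
  set σ : ℝ≥0 := (2 / L).toNNReal with hσ
  have hσ' : (σ : ℝ≥0∞) = ENNReal.ofReal (2 / L) := rfl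
  have hlevel := mul_volume_le_weakL1Norm L (kappaStar L γ) σ
  -- the level set contains a.e. point of `Ico 0 L`
  have hsub : volume (Ico (0:ℝ) L) ≤
      volume {s : ℝ | s ∈ Ico 0 L ∧ (σ : ℝ≥0∞) ≤ kappaStar L γ s} := by
    have hbad : volume {s : ℝ | ¬ (DifferentiableAt ℝ γ s ∧ ‖deriv γ s‖ = 1)} = 0 := by
      have := hγ.ae_good
      rw [ae_iff] at this
      exact this
    calc volume (Ico (0:ℝ) L)
        ≤ volume ({s : ℝ | s ∈ Ico 0 L ∧ (σ : ℝ≥0∞) ≤ kappaStar L γ s} ∪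
            {s : ℝ | ¬ (DifferentiableAt ℝ γ s ∧ ‖deriv γ s‖ = 1)}) := by
          refine measure_mono fun x hx => ?_
          by_cases hgood : DifferentiableAt ℝ γ x ∧ ‖deriv γ x‖ = 1
          · left; exact ⟨hx, hσ' ▸ hγ.ofReal_two_div_le_kappaStar hgood.2⟩
          · right; exact hgood
      _ ≤ volume {s : ℝ | s ∈ Ico 0 L ∧ (σ : ℝ≥0∞) ≤ kappaStar L γ s} +
            volume {s : ℝ | ¬ (DifferentiableAt ℝ γ s ∧ ‖deriv γ s‖ = 1)} := measure_union_le _ _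
      _ = _ := by rw [hbad, add_zero]
  rw [Real.volume_Ico, sub_zero] at hsub
  have h2 : (2 : ℝ≥0∞) ≤ (σ : ℝ≥0∞) * ENNReal.ofReal L := by
    rw [hσ', ← ENNReal.ofReal_mul (by positivity)]
    have : (2 / L) * L = 2 := by field_simp
    rw [this, ENNReal.ofReal_ofNat]
  have h3 : (2 : ℝ≥0∞) ≤ (K : ℝ≥0∞) := by
    refine h2.trans (le_trans ?_ (hlevel.trans hK))
    gcongr
  have : ((2 : ℝ≥0) : ℝ≥0∞) ≤ (K : ℝ≥0∞) := by simpa using h3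
  have h4 : (2 : ℝ≥0) ≤ K := by exact_mod_cast this
  exact_mod_cast h4

end Security

/-! ### Lemma 4: the curve spends little parameter time near any point -/

section Lemma4

variable {L : ℝ} {γ : ℝ → EuclideanSpace ℝ (Fin 3)}

/-- The weak-`L¹` hypothesis as a bound on level sets: `|{s ∈ [0,L) : κ*(s) ≥ σ}| ≤ K/σ`.
[cite: JerrardSeis2016, §2.1 eq. (4)] -/
theorem volume_level_le {K : ℝ≥0} (hK : weakL1Norm L (kappaStar L γ) ≤ K) {σ : ℝ}
    (hσ : 0 < σ) :
    volume {s : ℝ | s ∈ Ico 0 L ∧ ENNReal.ofReal σ ≤ kappaStar L γ s} ≤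
      ENNReal.ofReal (K / σ) := by
  have h := (weakL1Norm_le_iff.1 hK) σ.toNNReal
  have hσ' : ((σ.toNNReal : ℝ≥0) : ℝ≥0∞) = ENNReal.ofReal σ := rfl
  rw [hσ'] at h
  rw [ENNReal.ofReal_div_of_pos hσ, ENNReal.ofReal_coe_nnreal]
  refine (ENNReal.le_div_iff_mul_le (Or.inl ?_) (Or.inl ENNReal.ofReal_ne_top)).2 ?_
  · exact (ENNReal.ofReal_pos.2 hσ).ne'
  · rwa [mul_comm]

/-- The parameters in a period at loop distance `≤ δ` from `s₀` have measure `≤ 2δ`.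
[folklore] -/
theorem volume_loopBall_le {L : ℝ} (hL : 0 < L) (s₀ : ℝ) (δ : ℝ) :
    volume {t : ℝ | t ∈ Ico 0 L ∧ loopDist L (t - s₀) ≤ δ} ≤ ENNReal.ofReal (2 * δ) := by
  haveI : Fact (0 < L) := ⟨hL⟩
  have hmp := AddCircle.measurePreserving_mk L (0 : ℝ)
  rw [zero_add] at hmp
  set B : Set (AddCircle L) := Metric.closedBall ((s₀ : ℝ) : AddCircle L) δ with hB
  have hpre : {t : ℝ | t ∈ Ico 0 L ∧ loopDist L (t - s₀) ≤ δ} =ᵐ[volume]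
      (((↑) : ℝ → AddCircle L) ⁻¹' B ∩ Ioc 0 L : Set ℝ) := by
    have h1 : {t : ℝ | t ∈ Ico 0 L ∧ loopDist L (t - s₀) ≤ δ} =
        ((↑) : ℝ → AddCircle L) ⁻¹' B ∩ Ico 0 L := by
      ext t
      simp only [mem_setOf_eq, mem_inter_iff, mem_preimage, hB, Metric.mem_closedBall,
        AddCircle.coe_sub, loopDist, dist_eq_norm]
      tauto
    rw [h1]
    exact (ae_eq_refl _).inter Ico_ae_eq_Ioc
  rw [measure_congr hpre]
  have h2 : volume (((↑) : ℝ → AddCircle L) ⁻¹' B ∩ Ioc 0 L) = volume B := by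
    rw [← Measure.restrict_apply' measurableSet_Ioc]
    exact hmp.measure_preimage measurableSet_closedBall.nullMeasurableSet
  rw [h2, hB, AddCircle.volume_closedBall]
  exact ENNReal.ofReal_le_ofReal (min_le_right _ _)

variable (hγ : IsArclengthLoop L γ)
include hγ

/-- Key step of Lemma 4: if two parameters of the near-set `{‖γ − x‖ < r}` are more than `4r`
apart on the loop, every admissible radius at the first one is `≤ 4r`. [cite: JerrardSeis2016, §4.1 Lemma 4 (proof, Case 2)] -/
theorem IsArclengthLoop.mem_securityRadii_le_of_far {x : EuclideanSpace ℝ (Fin 3)} {r s t ρ : ℝ}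
    (hs : ‖deriv γ s‖ = 1) (hsx : ‖γ s - x‖ < r) (htx : ‖γ t - x‖ < r)
    (hfar : 4 * r < loopDist L (t - s)) (hρ : ρ ∈ securityRadii L γ s) : ρ ≤ 4 * r := by
  by_contra! hρ4
  have hL := hγ.pos
  have hρpos : 0 < ρ := hρ.1
  have hr : 0 < r := lt_of_le_of_lt (norm_nonneg _) hsx
  set d : ℝ := loopDist L (t - s) with hd
  set k : ℤ := round (L⁻¹ * (t - s)) with hk
  set h₀ : ℝ := (t - s) - k * L with hh₀
  have hh₀d : |h₀| = d := by rw [hd, loopDist_eq]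
  have hld₀ : loopDist L h₀ = d := by rw [hh₀, loopDist_sub_int_mul]
  have hγh₀ : γ (s + h₀) = γ t := by
    have : s + h₀ = t - k * L := by rw [hh₀]; ring
    rw [this]
    exact hγ.periodic.sub_int_mul_eq k
  have hclose : ‖γ (s + h₀) - γ s‖ < 2 * r := by
    rw [hγh₀]
    calc ‖γ t - γ s‖ = ‖(γ t - x) - (γ s - x)‖ := by congr 1; abel
      _ ≤ ‖γ t - x‖ + ‖γ s - x‖ := norm_sub_le _ _
      _ < r + r := add_lt_add htx hsx
      _ = 2 * r := by ring
  rcases le_or_gt ρ d with hρd | hρd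
  · -- first admissibility condition is violated
    have := hρ.2.1 h₀ (hld₀ ▸ hρd)
    linarith
  · -- second condition forces the chord to be long
    have hdpos : 0 < d := by linarith
    have hh₀ne : h₀ ≠ 0 := by
      intro h0; rw [h0, abs_zero] at hh₀d; linarith
    have hq : d / ρ < 1 := (div_lt_one hρpos).2 hρd
    have hae : ∀ᵐ h : ℝ, h ∈ Set.uIcc 0 h₀ → 1 / 2 ≤ ⟪deriv γ (s + h), deriv γ s⟫ := by
      filter_upwards [hγ.ae_norm_deriv_add s] with h hh hmem
      have habs : |h| ≤ d := by
        rw [← hh₀d]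
        rcases le_or_gt 0 h₀ with h0 | h0
        · rw [Set.uIcc_of_le h0] at hmem
          rw [abs_of_nonneg hmem.1, abs_of_nonneg h0]; exact hmem.2
        · rw [Set.uIcc_of_ge h0.le] at hmem
          rw [abs_of_nonpos hmem.2, abs_of_neg h0]; linarith [hmem.1]
      have hld : loopDist L h ≤ ρ := ((loopDist_le_abs L h).trans habs).trans hρd.le
      have h1 := inner_deriv_ge_of_mem_securityRadii hρ hld hs hh
      have h2 : loopDist L h / ρ ≤ d / ρ := by
        gcongr; exact (loopDist_le_abs L h).trans habs
      have h3 : (loopDist L h / ρ) ^ 2 ≤ (d / ρ) ^ 2 :=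
        pow_le_pow_left₀ (div_nonneg (loopDist_nonneg _ _) hρpos.le) h2 2
      have h4 : (d / ρ) ^ 2 < 1 := by
        have : 0 ≤ d / ρ := by positivity
        nlinarith
      linarith
    have hftc : ⟪γ (s + h₀) - γ s, deriv γ s⟫ = ∫ h in (0:ℝ)..h₀, ⟪deriv γ (s + h), deriv γ s⟫ := by
      rw [hγ.inner_sub_eq_integral (deriv γ s) s (s + h₀),
        intervalIntegral.integral_comp_add_left (fun σ => ⟪deriv γ σ, deriv γ s⟫) s, add_zero]
    have hbound : |⟪γ (s + h₀) - γ s, deriv γ s⟫| < 2 * r := by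
      calc |⟪γ (s + h₀) - γ s, deriv γ s⟫| ≤ ‖γ (s + h₀) - γ s‖ * ‖deriv γ s‖ :=
            abs_real_inner_le_norm _ _
        _ = ‖γ (s + h₀) - γ s‖ := by rw [hs, mul_one]
        _ < 2 * r := hclose
    have hint := hγ.intervalIntegrable_inner_deriv_add s (deriv γ s)
    rcases lt_or_gt_of_ne hh₀ne with hneg | hpos
    · -- h₀ < 0
      have hmono : ∫ h in h₀..(0:ℝ), (1 / 2 : ℝ) ≤ ∫ h in h₀..(0:ℝ), ⟪deriv γ (s + h), deriv γ s⟫ := by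
        refine intervalIntegral.integral_mono_ae_restrict hneg.le intervalIntegrable_const
          (hint h₀ 0) ?_
        rw [Filter.EventuallyLE, ae_restrict_iff' measurableSet_Icc]
        filter_upwards [hae] with h hh hmem
        exact hh (by rwa [Set.uIcc_of_ge hneg.le])
      rw [intervalIntegral.integral_const, smul_eq_mul] at hmono
      rw [intervalIntegral.integral_symm] at hftc
      have : d / 2 ≤ -⟪γ (s + h₀) - γ s, deriv γ s⟫ := by
        rw [hftc, neg_neg]
        have : |h₀| = -h₀ := abs_of_neg hneg
        nlinarith
      have hb := (abs_lt.1 hbound).1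
      linarith
    · -- 0 < h₀
      have hmono : ∫ h in (0:ℝ)..h₀, (1 / 2 : ℝ) ≤ ∫ h in (0:ℝ)..h₀, ⟪deriv γ (s + h), deriv γ s⟫ := by
        refine intervalIntegral.integral_mono_ae_restrict hpos.le intervalIntegrable_const
          (hint 0 h₀) ?_
        rw [Filter.EventuallyLE, ae_restrict_iff' measurableSet_Icc]
        filter_upwards [hae] with h hh hmem
        exact hh (by rwa [Set.uIcc_of_le hpos.le])
      rw [intervalIntegral.integral_const, smul_eq_mul] at hmono
      have : d / 2 ≤ ⟪γ (s + h₀) - γ s, deriv γ s⟫ := by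
        rw [hftc]
        have : |h₀| = h₀ := abs_of_pos hpos
        nlinarith
      have hb := (abs_lt.1 hbound).2
      linarith

/-- **Jerrard–Seis Lemma 4.** For every `x ∈ EuclideanSpace ℝ (Fin 3)` and `r > 0`,
`|{s ∈ [0,L) : |γ(s) − x| < r}| ≤ 24 r ‖κ*‖_{L^{1,∞}}`: the curve spends parameter time at most
`O(r K)` in any ball of radius `r`. [cite: JerrardSeis2016, §4.1 Lemma 4] -/
theorem IsArclengthLoop.volume_near_le {K : ℝ≥0} (hK : weakL1Norm L (kappaStar L γ) ≤ K)
    (x : EuclideanSpace ℝ (Fin 3)) {r : ℝ} (hr : 0 < r) :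
    volume {s : ℝ | s ∈ Ico 0 L ∧ ‖γ s - x‖ < r} ≤ ENNReal.ofReal (24 * r * K) := by
  have hL := hγ.pos
  have hK2 := hγ.two_le_of_weakL1Norm_le hK
  set A := {s : ℝ | s ∈ Ico 0 L ∧ ‖γ s - x‖ < r} with hA
  by_cases hcase : ∃ s₀ ∈ A, ∀ t ∈ A, loopDist L (t - s₀) ≤ 4 * r
  · obtain ⟨s₀, -, hall⟩ := hcase
    calc volume A ≤ volume {t : ℝ | t ∈ Ico 0 L ∧ loopDist L (t - s₀) ≤ 4 * r} :=
          measure_mono fun t ht => ⟨ht.1, hall t ht⟩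
      _ ≤ ENNReal.ofReal (2 * (4 * r)) := volume_loopBall_le hL s₀ (4 * r)
      _ ≤ ENNReal.ofReal (24 * r * K) := by
          apply ENNReal.ofReal_le_ofReal; nlinarith
  · push Not at hcase
    have hbad : volume {s : ℝ | ¬ (DifferentiableAt ℝ γ s ∧ ‖deriv γ s‖ = 1)} = 0 := by
      have := hγ.ae_good
      rw [ae_iff] at this
      exact this
    have hσ : (0 : ℝ) < 1 / (4 * r) := by positivity
    calc volume A
        ≤ volume ({s : ℝ | s ∈ Ico 0 L ∧ ENNReal.ofReal (1 / (4 * r)) ≤ kappaStar L γ s} ∪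
            {s : ℝ | ¬ (DifferentiableAt ℝ γ s ∧ ‖deriv γ s‖ = 1)}) := by
          refine measure_mono fun s hs => ?_
          by_cases hgood : DifferentiableAt ℝ γ s ∧ ‖deriv γ s‖ = 1
          · left
            refine ⟨hs.1, ?_⟩
            obtain ⟨t, ht, hfar⟩ := hcase s hs
            have hsec : securityRadius L γ s ≤ ENNReal.ofReal (4 * r) := by
              rw [securityRadius, if_pos hgood.1]
              exact iSup₂_le fun ρ hρ => ENNReal.ofReal_le_ofReal
                (hγ.mem_securityRadii_le_of_far hgood.2 hs.2 ht.2 hfar hρ)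
            rw [kappaStar, one_div, ENNReal.ofReal_inv_of_pos (by positivity)]
            exact ENNReal.inv_le_inv.2 hsec
          · right; exact hgood
      _ ≤ volume {s : ℝ | s ∈ Ico 0 L ∧ ENNReal.ofReal (1 / (4 * r)) ≤ kappaStar L γ s} +
            volume {s : ℝ | ¬ (DifferentiableAt ℝ γ s ∧ ‖deriv γ s‖ = 1)} := measure_union_le _ _
      _ ≤ ENNReal.ofReal (K / (1 / (4 * r))) + 0 := by
          rw [hbad]; exact add_le_add (volume_level_le hK hσ) le_rfl
      _ ≤ ENNReal.ofReal (24 * r * K) := by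
          rw [add_zero]; apply ENNReal.ofReal_le_ofReal
          rw [div_div_eq_mul_div, div_one]
          have : (0:ℝ) ≤ K := K.2
          nlinarith

end Lemma4

end VortexFilament

end Literature.Analysis.FluidPDE
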